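import Literature.Computability.AlgebraicComplexity.KaltofenFactorClosureProofs
import Literature.Computability.AlgebraicComplexity.ValiantClasses
import HarnessLib

/-!
# `VP` is closed under taking factors (Bürgisser 2024, Cor. 3.3) — PROVED over every field of
# characteristic zero

P. Bürgisser, *Completeness classes in algebraic complexity theory* (2024), Cor. 3.3 (of Kaltofen's
Thm. 3.2): "`VP` is closed under taking factors" — if `(f_n) ∈ VP` and `g_n ∣ f_n` for all `n`,
then `(g_n) ∈ VP`. With Kaltofen's factor bound now PROVED in the tree over algebraically closed
fields of characteristic zero (`kaltofenFactorBoundWith_of_isAlgClosed : KaltofenFactorBoundWith F 12`,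
`KaltofenFactorClosureProofs.lean`), the corollary is a theorem there for the tree's predicates
`IsPComputable` / `IsVPFamily` (`ValiantClasses.lean`, Bürgisser 2000 Def. 2.2/2.4):

* `IsPComputable.of_dvd` — a p-computable family of p-bounded degree has p-computable factors
  (`L(g_n) ≤ (L(f_n) + deg f_n + 2)^12`);
* `IsVPFamily.of_dvd` — **`VP` is closed under taking factors** (degrees of factors do not grow,
  `totalDegree_le_of_dvd_of_isDomain`).

The hypothesis `f_n ≠ 0` is necessary for the wording "`g_n ∣ f_n`" (everything divides `0`).
Scope: `IsPComputable.of_dvd` / `IsVPFamily.of_dvd` over algebraically closed fields of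
characteristic zero (exponent `12`), and `IsPComputable.of_dvd_charZero` /
`IsVPFamily.of_dvd_charZero` over EVERY field of characteristic zero — the printed scope —
(exponent `17`, from `kaltofenFactorBoundWith_of_charZero`, the étale-descent discharge of the
named fact `KaltofenFactorBound F`); in positive characteristic it is false as worded (only
`g^{p^k}` has small circuits in general). Honest framing: a 1989/2024 published statement
formalised; nothing here bears on `VP ≠ VNP`, which is NOT proved.

## References

* [Burgisser2024Completeness] P. Bürgisser, arXiv:2406.06217, Thm. 3.2 and Cor. 3.3.
* [Kaltofen1989] E. Kaltofen, *Factorization of polynomials given by straight-line programs* (1989).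
* [Burgisser2000] P. Bürgisser, *Completeness and Reduction in Algebraic Complexity Theory*,
  Def. 2.2–2.4 (and Thm. 2.21 ff. on factors).
-/

noncomputable section

open MvPolynomial

universe u v

namespace Literature.Computability.AlgebraicComplexity

variable {F : Type u} [Field F] [IsAlgClosed F] [CharZero F] {σ : ℕ → Type v}
  [∀ n, Fintype (σ n)]

/-- **Factors of a p-computable family of p-bounded degree are p-computable** (Kaltofen 1989;
Bürgisser 2024 Thm. 3.2 ⇒ Cor. 3.3), over an algebraically closed field of characteristic zero:
`L(g_n) ≤ (L(f_n) + deg f_n + 2)^12` after renaming the variables to `Fin #σ(n)`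
(`kaltofenFactorBoundWith_of_isAlgClosed`, `complexity_renameEquiv`).
[cite: Burgisser2024Completeness, Thm. 3.2 and Cor. 3.3] -/
theorem IsPComputable.of_dvd {f g : ∀ n, MvPolynomial (σ n) F} (hf : IsPComputable f)
    (hdeg : IsPBounded fun n => (f n).totalDegree) (hne : ∀ n, f n ≠ 0)
    (hg : ∀ n, g n ∣ f n) : IsPComputable g := by
  refine (IsPBounded.pow_holds (IsPBounded.add_holds (IsPBounded.add_holds hf hdeg)
    (IsPBounded.const 2)) 12).mono fun n => ?_
  set e : σ n ≃ Fin (Fintype.card (σ n)) := Fintype.equivFin (σ n) with he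
  have hne' : rename e (f n) ≠ 0 := (map_ne_zero_iff _ (rename_injective _ e.injective)).2 (hne n)
  have hdvd : rename e (g n) ∣ rename e (f n) := map_dvd _ (hg n)
  have hk := kaltofenFactorBoundWith_of_isAlgClosed F _ (rename e (f n)) (rename e (g n)) hne' hdvd
  have h1 : complexity (rename e (g n)) = complexity (g n) := complexity_renameEquiv_holds e (g n)
  have h2 : complexity (rename e (f n)) = complexity (f n) := complexity_renameEquiv_holds e (f n)
  have h3 : (rename e (f n)).totalDegree = (f n).totalDegree := totalDegree_renameEquiv e (f n)
  rw [h1, h2, h3] at hk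
  exact hk

/-- **`VP` is closed under taking factors** (Bürgisser 2024, Cor. 3.3 of Kaltofen's theorem),
over an algebraically closed field of characteristic zero: if `(f_n)` is a p-computable p-family
with `f_n ≠ 0` and `g_n ∣ f_n` for every `n` (in the same variables), then `(g_n)` is a
p-computable p-family. [cite: Burgisser2024Completeness, Cor. 3.3] -/
theorem IsVPFamily.of_dvd {f g : ∀ n, MvPolynomial (σ n) F} (hf : IsVPFamily f)
    (hne : ∀ n, f n ≠ 0) (hg : ∀ n, g n ∣ f n) : IsVPFamily g := by
  obtain ⟨⟨hcard, hdeg⟩, hcomp⟩ := hf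
  exact ⟨⟨hcard, hdeg.mono fun n => totalDegree_le_of_dvd_of_isDomain (hg n) (hne n)⟩,
    hcomp.of_dvd hdeg hne hg⟩

/-! ### Every field of characteristic zero (exponent `17`) -/

omit [IsAlgClosed F] in
/-- **Factors of a p-computable family of p-bounded degree are p-computable, over EVERY field of
characteristic zero** (Kaltofen 1989; Bürgisser 2024 Thm. 3.2 ⇒ Cor. 3.3):
`L(g_n) ≤ (L(f_n) + deg f_n + 2)^17` (`kaltofenFactorBoundWith_of_charZero`, the étale-descent
discharge of `KaltofenFactorBound F`). [cite: Burgisser2024Completeness, Thm. 3.2 and Cor. 3.3] -/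
theorem IsPComputable.of_dvd_charZero {f g : ∀ n, MvPolynomial (σ n) F} (hf : IsPComputable f)
    (hdeg : IsPBounded fun n => (f n).totalDegree) (hne : ∀ n, f n ≠ 0)
    (hg : ∀ n, g n ∣ f n) : IsPComputable g := by
  refine (IsPBounded.pow_holds (IsPBounded.add_holds (IsPBounded.add_holds hf hdeg)
    (IsPBounded.const 2)) 17).mono fun n => ?_
  set e : σ n ≃ Fin (Fintype.card (σ n)) := Fintype.equivFin (σ n) with he
  have hne' : rename e (f n) ≠ 0 := (map_ne_zero_iff _ (rename_injective _ e.injective)).2 (hne n)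
  have hdvd : rename e (g n) ∣ rename e (f n) := map_dvd _ (hg n)
  have hk := kaltofenFactorBoundWith_of_charZero F _ (rename e (f n)) (rename e (g n)) hne' hdvd
  have h1 : complexity (rename e (g n)) = complexity (g n) := complexity_renameEquiv_holds e (g n)
  have h2 : complexity (rename e (f n)) = complexity (f n) := complexity_renameEquiv_holds e (f n)
  have h3 : (rename e (f n)).totalDegree = (f n).totalDegree := totalDegree_renameEquiv e (f n)
  rw [h1, h2, h3] at hk
  exact hk

omit [IsAlgClosed F] in
/-- **`VP` is closed under taking factors over EVERY field of characteristic zero** (Bürgisser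
2024, Cor. 3.3 of Kaltofen's theorem — exactly the printed scope): if `(f_n)` is a p-computable
p-family with `f_n ≠ 0` and `g_n ∣ f_n` for every `n` (in the same variables), then `(g_n)` is a
p-computable p-family. [cite: Burgisser2024Completeness, Cor. 3.3] -/
theorem IsVPFamily.of_dvd_charZero {f g : ∀ n, MvPolynomial (σ n) F} (hf : IsVPFamily f)
    (hne : ∀ n, f n ≠ 0) (hg : ∀ n, g n ∣ f n) : IsVPFamily g := by
  obtain ⟨⟨hcard, hdeg⟩, hcomp⟩ := hf
  exact ⟨⟨hcard, hdeg.mono fun n => totalDegree_le_of_dvd_of_isDomain (hg n) (hne n)⟩,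
    hcomp.of_dvd_charZero hdeg hne hg⟩

end Literature.Computability.AlgebraicComplexity

end
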